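import Mathlib
import Summits.Ventures.PercRepro2.CrossAPrimeEdgeIdentities
import Summits.Ventures.PercRepro2.CrossAPrimePendant
import Summits.Ventures.PercRepro2.CrossAPrimeInduction

/-!
# The mixed sign `MixedSign` as the open statement of record
(blind cell PercRepro2, p5 g33; `proofs/P5-OEDGE.md` §43, S4 §2.4 (s) addendum 24)

**`MixedSign`** is the inequality `0 ≤ first + M(m¹; m⁰)` of `CrossAPrimeEdgeIdentities` — equivalently
`E₂ ≥ B₃`, the second Bernstein excess of `crossA′so` along a root edge `e = {r, w}` dominates the
value with `e` open — for every weight vector, every root `r` and every random edge `{r, w}` with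
`w ∉ {a₂, v}`.  By `reduction_of_mixed` it gives the root-edge reduction
`(1 − p e)²·crossA′so(p[e ↦ 0]) ≤ crossA′so(p)` from `0 ≤ crossA′so(p[e ↦ 1])` alone, hence the
predecessor's open statement `RootEdgeReductionStep` (**`rootEdgeReductionStep_of_mixedSign`**)
and, through its induction `crossA'so_nonneg_of_step`, the sign of `crossA′so` for every weight
vector and root (**`crossA'so_nonneg_of_mixedSign`**).  At a pendant root the mixed form
`M(m¹; m⁰)` vanishes (`mixed_update_eq_zero_of_pendant`), so `MixedSign` holds there by
`first_nonneg` (**`mixedSign_of_pendant`**).  Own work; standard axioms.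
-/

namespace Summit.Ventures.PercRepro2

open LeafRowPendantRootSO CrossAPrimeEdgeIdentities CrossAPrimePendant CrossAPrimeInduction

namespace CrossAPrimeMixedSign

section Main

variable {V : Type*} {E : Type*} [Fintype E] [DecidableEq E] [Fintype V] [DecidableEq V]
  {R : Type*} [Field R] [LinearOrder R] [IsStrictOrderedRing R]
variable {ends : E → Sym2 V}

/-- **The mixed sign**: along every random root edge `e = {r, w}` with `w ∉ {a₂, v}`,
`0 ≤ first + M(m¹; m⁰)` (i.e. `E₂ ≥ B₃`). -/
def MixedSign (ends : E → Sym2 V) (o a₂ v b : V) : Prop :=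
  ∀ (p : E → R) (r w : V) (e : E), IsProbVec p → ends e = s(r, w) → r ≠ w → w ≠ a₂ → w ≠ v →
    p e ≠ 0 → p e ≠ 1 →
    0 ≤ first p e ends o r a₂ v b +
      mixed (Function.update p e 1) (Function.update p e 0) ends o r a₂ v b

omit [Fintype V] in
/-- **`RootEdgeReductionStep` from the mixed sign.** -/
theorem rootEdgeReductionStep_of_mixedSign {o a₂ v b : V} (H : MixedSign (R := R) ends o a₂ v b) :
    RootEdgeReductionStep (R := R) ends o a₂ v b := by
  intro p r w e hp he hrw hw2 hwv h0 h1 _ hs1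
  exact reduction_of_mixed hp he o a₂ v b hs1 (H p r w e hp he hrw hw2 hwv h0 h1)

/-- **The sign of `crossA′so` from the mixed sign.** -/
theorem crossA'so_nonneg_of_mixedSign {o a₂ v b : V} (H : MixedSign (R := R) ends o a₂ v b) :
    ∀ (p : E → R), IsProbVec p → ∀ a₁, 0 ≤ crossA'so p ends o a₁ a₂ v b :=
  crossA'so_nonneg_of_step (rootEdgeReductionStep_of_mixedSign H)

omit [Fintype V] [DecidableEq V] [LinearOrder R] [IsStrictOrderedRing R] in
/-- At a pendant root the mixed form vanishes (the `v`-masses of `p[e ↦ 0]` are `0`). -/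
lemma mixed_update_eq_zero_of_pendant {p : E → R} {a₁ : V} {e : E}
    (hpend : ∀ f, a₁ ∈ ends f → f ≠ e → p f = 0) (o a₂ : V) {v : V} (hv : v ≠ a₁) (b : V) :
    mixed (Function.update p e 1) (Function.update p e 0) ends o a₁ a₂ v b = 0 := by
  unfold mixed
  simp only [prob_update_zero_vL_inter hpend hv, prob_update_zero_vL hpend hv, mul_zero, zero_mul,
    sub_zero, add_zero]

/-- **The mixed sign at a pendant root** (consistency with `CrossAPrimePendant`). -/
theorem mixedSign_of_pendant {p : E → R} (hp : IsProbVec p) {e : E} {a₁ u : V}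
    (he : ends e = s(a₁, u)) (hpend : ∀ f, a₁ ∈ ends f → f ≠ e → p f = 0) (o a₂ : V) {v : V}
    (hv : v ≠ a₁) (b : V) :
    0 ≤ first p e ends o a₁ a₂ v b +
      mixed (Function.update p e 1) (Function.update p e 0) ends o a₁ a₂ v b := by
  rw [mixed_update_eq_zero_of_pendant hpend o a₂ hv b, add_zero]
  exact first_nonneg hp he o a₂ v b

end Main

end CrossAPrimeMixedSign

end Summit.Ventures.PercRepro2
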